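import Literature.Topology.CoveringSpaces.UniversalCoverGroupKernel
import Mathlib.Topology.PartitionOfUnity
import Mathlib.MeasureTheory.Measure.Haar.Basic
import Mathlib.MeasureTheory.Group.Integral
import Mathlib.MeasureTheory.Integral.Bochner.Basic
import Mathlib.MeasureTheory.Function.LocallyIntegrable
import Mathlib.Analysis.SpecialFunctions.Complex.Circle
import Mathlib.GroupTheory.FiniteAbelian.Basic
import Mathlib.GroupTheory.Finiteness
import HarnessLib

/-!
# Characters of the universal covering group of a compact group; finiteness of `π₁`

Topic `Literature/Topology/CoveringSpaces`.  Continuation of `UniversalCoverGroup.lean`,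
`UniversalCoverGroupKernel.lean` (the universal covering group `p : G̃ →* G`, `G̃ = UniversalCover G 1`,
with discrete central kernel `K = ker p ≃ π₁(G, 1)`).  For a COMPACT Hausdorff, path connected,
strongly locally contractible topological group `G` (e.g. a compact connected Lie group) we prove
the classical cohomological criterion behind H. Weyl's theorem on the finiteness of `π₁` of a
compact semisimple Lie group:

* `UniversalCover.exists_continuous_quasiPeriodic`, `exists_continuous_defect`,
  **`exists_continuous_add_extend`** — every additive map `φ : K → ℝ` extends to a continuous
  homomorphism `ψ : G̃ → (ℝ, +)`.  Proof: local continuous sections of the covering `p` (a local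
  homeomorphism) and a partition of unity on `G` give a continuous `u : G̃ → ℝ` with
  `u (y k) = u y + φ k` (`k ∈ K`); its defect `u (x y) - u x - u y` is `K × K`-invariant, hence
  a continuous 2-cocycle `c` on the compact group `G`, and `c (a, b) = F a + F b - F (a b)` for
  the Haar average `F a = ∫ c (a, h) dh`; then `ψ = u + F ∘ p` (the standard averaging
  argument by which a central extension of a compact group by `ℝ` with a continuous local
  section splits, i.e. the vanishing of continuous `H²(G; ℝ)` for compact `G`).
* `UniversalCover.addMonoidHom_ker_eq_zero_of_forall_character` — consequently, **if every
  continuous character `χ : G →* Circle` is trivial, then `Hom(K, ℤ) = 0`** (`e^{2πiψ}` descends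
  to a character of `G = G̃ / K`; if it is trivial, `ψ` is a continuous `ℤ`-valued function on
  the path connected `G̃` vanishing at `1`, so `ψ = 0`).
* `UniversalCover.smul_eq_smul_one_mul`, `mul_smul_one`, `exists_mulEquiv_ker_projHom` — the
  bijection `π₁(G, 1) → K`, `α ↦ α • 1̃` of `UniversalCoverGroupKernel.lean` **is a group
  isomorphism** (the deck transformation `α • ·` and left multiplication by `α • 1̃` are lifts
  of `p` through `p` agreeing at `1̃`, Hatcher Prop. 1.34); hence `K` is finitely generated when
  `π₁(G, 1)` is (`fg_ker_projHom`).
* `UniversalCover.finite_fundamentalGroup_of_forall_character`,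
  `compactSpace_of_forall_character` — **if `π₁(G, 1)` is finitely generated and every
  continuous character of `G` is trivial, then `π₁(G, 1)` is finite**, so `G̃` is compact with
  finite kernel (a finitely generated abelian group with no non-zero homomorphism to `ℤ` is
  finite, `finite_of_fg_of_forall_addMonoidHom_int_eq_zero`, by the structure theorem
  `AddCommGroup.equiv_free_prod_directSum_zmod`; compactness by `UniversalCoverCompact.lean`).

This is the covering-space half of "a compact connected Lie group with semisimple Lie algebra
has finite fundamental group, i.e. compact universal cover" (T. Bröcker, T. tom Dieck,
*Representations of Compact Lie Groups* (1985), V (7.13); proved there via the Stiefel diagram,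
V (7.1)); the Lie-algebra half (continuous characters of a compact group with a faithful
representation and no non-trivial closed connected abelian normal subgroup are trivial) is in
`Literature/RepresentationTheory/CompactGroups/`.  Everything here is proved; there are no
named facts and no definitions.

## References

* T. Bröcker, T. tom Dieck, *Representations of Compact Lie Groups*, GTM 98, Springer 1985,
  V (7.1), (7.13). [BrockerTomDieck1985]
* M. R. Sepanski, *Compact Lie Groups*, GTM 235, Springer 2007, Thm. 1.22. [Sepanski2007]
* A. Hatcher, *Algebraic Topology*, CUP 2002, §1.3 Prop. 1.34, 1.39. [HatcherAT2002]
-/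

noncomputable section

open Set Filter Topology TopologicalSpace MeasureTheory

namespace Literature.Topology.CoveringSpaces

universe u

/-! ### Two topological lemmas -/

/-- A product `ρ · g` is continuous when `ρ` is continuous with `tsupport ρ ⊆ U`, `U` open, and
`g` is continuous on `U` (outside `U` the product vanishes near every point). [folklore] -/
theorem continuous_mul_of_tsupport_subset {X : Type*} [TopologicalSpace X] {ρ g : X → ℝ}
    (hρ : Continuous ρ) {U : Set X} (hU : IsOpen U) (hsub : tsupport ρ ⊆ U)
    (hg : ContinuousOn g U) : Continuous fun x => ρ x * g x := by
  refine continuous_iff_continuousAt.2 fun x => ?_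
  by_cases hx : x ∈ U
  · exact hρ.continuousAt.mul (hg.continuousAt (hU.mem_nhds hx))
  · have hx' : x ∉ tsupport ρ := fun h => hx (hsub h)
    have h0 : ρ =ᶠ[𝓝 x] 0 := notMem_tsupport_iff_eventuallyEq.1 hx'
    have h1 : (fun x => ρ x * g x) =ᶠ[𝓝 x] fun _ => 0 := by
      filter_upwards [h0] with y hy
      simp [hy]
    exact (continuousAt_const.congr_of_eventuallyEq h1 :)

/-- A map which is continuous on `V` with values in a discrete subset `K` is locally constant on
`V`; hence its composite with ANY function is continuous on `V`. [folklore] -/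
theorem continuousOn_comp_of_discrete {X Y Z : Type*} [TopologicalSpace X] [TopologicalSpace Y]
    [TopologicalSpace Z] {m : X → Y} {V : Set X} (hm : ContinuousOn m V) {K : Set Y}
    [DiscreteTopology K] (hmK : ∀ x ∈ V, m x ∈ K) (Φ : Y → Z) :
    ContinuousOn (fun x => Φ (m x)) V := by
  intro x hx
  -- `{m x}` is open in `K`: `O ∩ K = {m x}` for some open `O`
  obtain ⟨O, hO, hOK⟩ : ∃ O : Set Y, IsOpen O ∧ Subtype.val ⁻¹' O = ({⟨m x, hmK x hx⟩} : Set K) :=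
    isOpen_induced_iff.1 (isOpen_discrete _)
  have hmem : m x ∈ O := by
    have : (⟨m x, hmK x hx⟩ : K) ∈ Subtype.val ⁻¹' O := by rw [hOK]; exact rfl
    exact this
  have hev : ∀ᶠ x' in 𝓝[V] x, m x' ∈ O := hm x hx (hO.mem_nhds hmem)
  have hev' : ∀ᶠ x' in 𝓝[V] x, Φ (m x') = Φ (m x) := by
    filter_upwards [hev, self_mem_nhdsWithin] with x' hx'O hx'V
    have : (⟨m x', hmK x' hx'V⟩ : K) ∈ Subtype.val ⁻¹' O := hx'O
    rw [hOK] at this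
    have h := Subtype.ext_iff.1 (mem_singleton_iff.1 this)
    exact congrArg Φ h
  exact (tendsto_const_nhds.congr' (hev'.mono fun _ h => h.symm) :)

/-- **Parametric integrals of jointly continuous functions over a compact space are continuous**
(no countability assumption on the parameter space: uniform approximation from the tube lemma).
[folklore] -/
theorem continuous_integral_of_continuous_uncurry {X Y : Type*} [TopologicalSpace X]
    [TopologicalSpace Y] [CompactSpace Y] [MeasurableSpace Y] [OpensMeasurableSpace Y]
    (μ : Measure Y) [IsFiniteMeasure μ] {f : X → Y → ℝ} (hf : Continuous (Function.uncurry f)) :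
    Continuous fun x => ∫ y, f x y ∂μ := by
  have hfx : ∀ x, Continuous (f x) := fun x => hf.comp (Continuous.prodMk_right x)
  have hint : ∀ x, Integrable (f x) μ := fun x =>
    (hfx x).integrable_of_hasCompactSupport (HasCompactSupport.of_compactSpace _)
  refine continuous_iff_continuousAt.2 fun x₀ => Metric.tendsto_nhds.2 fun ε hε => ?_
  obtain ⟨δ, hδ, hδε⟩ : ∃ δ > 0, δ * μ.real univ < ε := by
    refine ⟨ε / (μ.real univ + 1), div_pos hε (by positivity), ?_⟩
    rw [div_mul_eq_mul_div, div_lt_iff₀ (by positivity), mul_add, mul_one]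
    linarith
  have hev : ∀ᶠ x in 𝓝 x₀, ∀ y ∈ (univ : Set Y), dist (f x y) (f x₀ y) < δ := by
    refine isCompact_univ.eventually_forall_of_forall_eventually fun y _ => ?_
    have hc : Continuous fun z : X × Y => dist (f z.1 z.2) (f x₀ z.2) :=
      hf.dist ((hfx x₀).comp continuous_snd)
    exact hc.continuousAt.eventually_lt continuousAt_const (by simpa using hδ)
  filter_upwards [hev] with x hx
  rw [dist_eq_norm, ← integral_sub (hint x) (hint x₀)]
  calc ‖∫ y, (f x y - f x₀ y) ∂μ‖ ≤ δ * μ.real univ := by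
        refine norm_integral_le_of_norm_le_const (ae_of_all _ fun y => ?_)
        rw [← dist_eq_norm]
        exact (hx y (mem_univ y)).le
    _ < ε := hδε

namespace UniversalCover

variable {G : Type u} [TopologicalSpace G] [Group G] [IsTopologicalGroup G]

/-! ### Extension of additive maps on `ker p` to continuous homomorphisms `G̃ → ℝ` -/

/-- **A continuous quasi-periodic function.**  For `G` compact Hausdorff, path connected and
strongly locally contractible and an additive `φ : ker p → ℝ` there is a continuous
`u : G̃ → ℝ` with `u (y k) = u y + φ k` for `k ∈ ker p` (local continuous sections of the
covering `p`, which is a local homeomorphism, glued by a partition of unity on `G`). [folklore] -/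
theorem exists_continuous_quasiPeriodic [CompactSpace G] [T2Space G] [PathConnectedSpace G]
    [StronglyLocallyContractibleSpace G]
    (φ : Additive (projHom (G := G)).ker →+ ℝ) :
    ∃ u : UniversalCover G (1 : G) → ℝ, Continuous u ∧
      ∀ (y : UniversalCover G (1 : G)) (k : (projHom (G := G)).ker),
        u (y * k) = u y + φ (Additive.ofMul k) := by
  classical
  have hcov : IsCoveringMap (projHom : UniversalCover G (1 : G) → G) := isCoveringMap_projHom
  have hpc : Continuous (projHom : UniversalCover G (1 : G) → G) := continuous_projHom
  have hsurj : Function.Surjective (projHom : UniversalCover G (1 : G) → G) := projHom_surjective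
  haveI : DiscreteTopology (projHom (G := G)).ker := discreteTopology_ker_projHom
  -- the extension of `φ` by zero to a function on `G̃`
  let Φ : UniversalCover G (1 : G) → ℝ := fun y =>
    if h : y ∈ (projHom (G := G)).ker then φ (Additive.ofMul ⟨y, h⟩) else 0
  have hΦK : ∀ k : (projHom (G := G)).ker, Φ k = φ (Additive.ofMul k) := fun k => by
    simp only [Φ, dif_pos k.2]
  have hΦ_mul : ∀ {a b : UniversalCover G (1 : G)}, a ∈ (projHom (G := G)).ker →
      b ∈ (projHom (G := G)).ker → Φ (a * b) = Φ a + Φ b := by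
    intro a b ha hb
    have hab : a * b ∈ (projHom (G := G)).ker := Subgroup.mul_mem _ ha hb
    have hprod : (⟨a * b, hab⟩ : (projHom (G := G)).ker) = ⟨a, ha⟩ * ⟨b, hb⟩ := rfl
    simp only [Φ, dif_pos ha, dif_pos hb, dif_pos hab]
    rw [hprod, ofMul_mul, map_add]
  -- ### local continuous sections of `p`
  have hsec : ∀ x : G, ∃ (W : Set G) (s : G → UniversalCover G (1 : G)), IsOpen W ∧ x ∈ W ∧
      ContinuousOn s W ∧ ∀ z ∈ W, projHom (s z) = z := by
    intro x
    obtain ⟨e, rfl⟩ := hsurj x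
    obtain ⟨h, he, hh⟩ := hcov.isLocalHomeomorph e
    refine ⟨h.target, h.symm, h.open_target, ?_, h.continuousOn_symm, fun z hz => ?_⟩
    · rw [hh]; exact h.map_source he
    · rw [hh]; exact h.right_inv hz
  choose W s hWo hxW hsc hps using hsec
  -- ### a finite subcover and a partition of unity subordinate to it
  obtain ⟨T, hT⟩ := isCompact_univ.elim_finite_subcover W hWo
    (fun x _ => mem_iUnion.2 ⟨x, hxW x⟩)
  obtain ⟨f, hf⟩ := PartitionOfUnity.exists_isSubordinate isClosed_univ (fun i : T => W i)
    (fun i => hWo i) (fun x _ => by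
      obtain ⟨i, hi, hx⟩ := mem_iUnion₂.1 (hT (mem_univ x))
      exact mem_iUnion.2 ⟨⟨i, hi⟩, hx⟩)
  -- ### the quasi-periodic function `u`
  let m : T → UniversalCover G (1 : G) → UniversalCover G (1 : G) :=
    fun i y => (s i (projHom y))⁻¹ * y
  have hmK : ∀ i : T, ∀ y ∈ (projHom : UniversalCover G (1 : G) → G) ⁻¹' W i,
      m i y ∈ (projHom (G := G)).ker := by
    intro i y hy
    rw [MonoidHom.mem_ker, map_mul, map_inv, hps i (projHom y) hy, inv_mul_cancel]
  have hm_cont : ∀ i : T,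
      ContinuousOn (m i) ((projHom : UniversalCover G (1 : G) → G) ⁻¹' W i) :=
    fun i => (((hsc i).comp hpc.continuousOn fun y hy => hy).inv).mul continuousOn_id
  refine ⟨fun y => ∑ i : T, f i (projHom y) * Φ (m i y), ?_, fun y k => ?_⟩
  · refine continuous_finsetSum _ fun i _ => ?_
    refine continuous_mul_of_tsupport_subset ((f i).continuous.comp hpc)
      ((hWo i).preimage hpc) ?_ (continuousOn_comp_of_discrete (hm_cont i) (hmK i) Φ)
    -- `tsupport (f i ∘ p) ⊆ p ⁻¹' tsupport (f i) ⊆ p ⁻¹' W i`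
    refine (closure_minimal ?_ ((isClosed_tsupport _).preimage hpc)).trans
      (preimage_mono (hf i))
    exact fun y hy => subset_closure hy
  · have hk : (k : UniversalCover G (1 : G)) ∈ (projHom (G := G)).ker := k.2
    have hpk : projHom (y * (k : UniversalCover G (1 : G))) = projHom y := by
      rw [map_mul, show projHom (k : UniversalCover G (1 : G)) = 1 from hk, mul_one]
    have hsum : ∑ i : T, f i (projHom y) = 1 := by
      have := f.sum_eq_one (mem_univ (projHom y))
      rwa [finsum_eq_sum_of_fintype] at this
    have hterm : ∀ i : T, f i (projHom (y * (k : UniversalCover G (1 : G)))) * Φ (m i (y * k)) =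
        f i (projHom y) * Φ (m i y) + f i (projHom y) * Φ k := by
      intro i
      rw [hpk]
      by_cases hi : f i (projHom y) = 0
      · rw [hi, zero_mul, zero_mul, zero_mul, zero_add]
      · have hy : projHom y ∈ W i := hf i (subset_closure (Function.mem_support.2 hi))
        have : m i (y * k) = m i y * k := by simp only [m, hpk, mul_assoc]
        rw [this, hΦ_mul (hmK i y hy) hk, mul_add]
    show ∑ i : T, f i (projHom (y * (k : UniversalCover G (1 : G)))) * Φ (m i (y * k)) =
      ∑ i : T, f i (projHom y) * Φ (m i y) + φ (Additive.ofMul k)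
    rw [Finset.sum_congr rfl fun i _ => hterm i, Finset.sum_add_distrib, ← Finset.sum_mul, hsum,
      one_mul, hΦK]

/-- **The defect of a quasi-periodic function descends to a continuous 2-cocycle on `G`.**
For `u` as in `exists_continuous_quasiPeriodic` there is a continuous `c : G × G → ℝ` with
`u (x y) - u x - u y = c (p x, p y)`. [folklore] -/
theorem exists_continuous_defect [PathConnectedSpace G] [StronglyLocallyContractibleSpace G]
    {φ : Additive (projHom (G := G)).ker →+ ℝ} {u : UniversalCover G (1 : G) → ℝ}
    (hu : Continuous u)
    (hu_mul : ∀ (y : UniversalCover G (1 : G)) (k : (projHom (G := G)).ker),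
      u (y * k) = u y + φ (Additive.ofMul k)) :
    ∃ c : G → G → ℝ, Continuous (Function.uncurry c) ∧
      ∀ x y : UniversalCover G (1 : G), c (projHom x) (projHom y) = u (x * y) - u x - u y := by
  have hcov : IsCoveringMap (projHom : UniversalCover G (1 : G) → G) := isCoveringMap_projHom
  have hpc : Continuous (projHom : UniversalCover G (1 : G) → G) := continuous_projHom
  have hsurj : Function.Surjective (projHom : UniversalCover G (1 : G) → G) := projHom_surjective
  -- invariance of the defect under `K × K`
  have hinv : ∀ (x y : UniversalCover G (1 : G)) (k k' : (projHom (G := G)).ker),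
      u (x * k * (y * k')) - u (x * k) - u (y * k') = u (x * y) - u x - u y := by
    intro x y k k'
    have : x * k * (y * k') = x * y * (k * k' : (projHom (G := G)).ker) := by
      rw [Subgroup.coe_mul, mul_assoc, mul_assoc, ← mul_assoc (k : UniversalCover G (1 : G)) y k',
        mul_comm_of_mem_ker k.2 y, mul_assoc]
    rw [this, hu_mul, hu_mul, hu_mul, ofMul_mul, map_add]
    ring
  -- a set-theoretic section of `p`
  let σ : G → UniversalCover G (1 : G) := Function.surjInv hsurj
  have hσ : ∀ a, projHom (σ a) = a := Function.surjInv_eq hsurj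
  have hσK : ∀ x : UniversalCover G (1 : G), x⁻¹ * σ (projHom x) ∈ (projHom (G := G)).ker :=
    fun x => by rw [MonoidHom.mem_ker, map_mul, map_inv, hσ, inv_mul_cancel]
  refine ⟨fun a b => u (σ a * σ b) - u (σ a) - u (σ b), ?_, fun x y => ?_⟩
  · have hq : IsQuotientMap
        (Prod.map projHom projHom : UniversalCover G (1 : G) × UniversalCover G (1 : G) → G × G) :=
      (hcov.isOpenMap.prodMap hcov.isOpenMap).isQuotientMap (hpc.prodMap hpc)
        (hsurj.prodMap hsurj)
    rw [hq.continuous_iff]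
    have : (Function.uncurry fun a b => u (σ a * σ b) - u (σ a) - u (σ b)) ∘
        Prod.map projHom projHom =
        fun z : UniversalCover G (1 : G) × UniversalCover G (1 : G) => u (z.1 * z.2) - u z.1 - u z.2 := by
      funext z
      show u (σ (projHom z.1) * σ (projHom z.2)) - u (σ (projHom z.1)) - u (σ (projHom z.2)) = _
      rw [← mul_inv_cancel_left z.1 (σ (projHom z.1)), ← mul_inv_cancel_left z.2 (σ (projHom z.2))]
      exact hinv z.1 z.2 ⟨_, hσK z.1⟩ ⟨_, hσK z.2⟩
    rw [this]
    fun_prop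
  · show u (σ (projHom x) * σ (projHom y)) - u (σ (projHom x)) - u (σ (projHom y)) = _
    rw [← mul_inv_cancel_left x (σ (projHom x)), ← mul_inv_cancel_left y (σ (projHom y))]
    exact hinv x y ⟨_, hσK x⟩ ⟨_, hσK y⟩

/-- **Every additive map `φ : ker p → ℝ` extends to a continuous homomorphism `ψ : G̃ → (ℝ, +)`**,
for `G` compact Hausdorff, path connected and strongly locally contractible: with `u` and `c`
as above, `c` is a continuous 2-cocycle on the compact group `G`, its Haar average
`F a = ∫ c (a, h) dh` satisfies `c (a, b) = F a + F b - F (a b)`, and `ψ = u + F ∘ p`.  (The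
averaging argument for the vanishing of the second continuous cohomology of a compact group
with real coefficients; it serves Bröcker–tom Dieck V (7.13) (i) ⇒ (iii).) [folklore] -/
theorem exists_continuous_add_extend [CompactSpace G] [T2Space G] [PathConnectedSpace G]
    [StronglyLocallyContractibleSpace G]
    (φ : Additive (projHom (G := G)).ker →+ ℝ) :
    ∃ ψ : UniversalCover G (1 : G) → ℝ, Continuous ψ ∧ (∀ x y, ψ (x * y) = ψ x + ψ y) ∧
      ∀ k : (projHom (G := G)).ker, ψ k = φ (Additive.ofMul k) := by
  obtain ⟨u, hu, hu_mul⟩ := exists_continuous_quasiPeriodic φ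
  obtain ⟨c, hc, hcu⟩ := exists_continuous_defect hu hu_mul
  have hpc : Continuous (projHom : UniversalCover G (1 : G) → G) := continuous_projHom
  have hsurj : Function.Surjective (projHom : UniversalCover G (1 : G) → G) := projHom_surjective
  -- the cocycle identity
  have hcocycle : ∀ a b d : G, c a b + c (a * b) d = c b d + c a (b * d) := by
    intro a b d
    obtain ⟨x, rfl⟩ := hsurj a
    obtain ⟨y, rfl⟩ := hsurj b
    obtain ⟨z, rfl⟩ := hsurj d
    rw [← map_mul, ← map_mul, hcu, hcu, hcu, hcu, mul_assoc]
    ring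
  -- ### Haar averaging
  letI : MeasurableSpace G := borel G
  haveI : BorelSpace G := ⟨rfl⟩
  haveI : Nonempty G := ⟨1⟩
  haveI : LocallyCompactSpace G := (⊤ : PositiveCompacts G).locallyCompactSpace_of_group
  let μ : Measure G := Measure.haarMeasure (⊤ : PositiveCompacts G)
  haveI : IsProbabilityMeasure μ :=
    ⟨by rw [← PositiveCompacts.coe_top (α := G)]; exact Measure.haarMeasure_self⟩
  have hint : ∀ {g : G → ℝ}, Continuous g → Integrable g μ := fun hg =>
    hg.integrable_of_hasCompactSupport (HasCompactSupport.of_compactSpace _)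
  have hc1 : ∀ a, Continuous (c a) := fun a => hc.comp (Continuous.prodMk_right a)
  let F : G → ℝ := fun a => ∫ h, c a h ∂μ
  have hF_cont : Continuous F := continuous_integral_of_continuous_uncurry μ hc
  have hF : ∀ a b : G, c a b + F (a * b) = F a + F b := by
    intro a b
    have h1 : ∫ h, (c a b + c (a * b) h) ∂μ = ∫ h, (c b h + c a (b * h)) ∂μ :=
      integral_congr_ae (ae_of_all _ fun h => hcocycle a b h)
    have hl : ∫ h, (c a b + c (a * b) h) ∂μ = c a b + F (a * b) := by
      simp only [F]
      rw [integral_add (integrable_const _) (hint (hc1 _)), integral_const, probReal_univ, one_smul]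
    have hr : ∫ h, (c b h + c a (b * h)) ∂μ = F b + F a := by
      have hcont : Continuous fun h => c a (b * h) := (hc1 a).comp (continuous_const_mul b)
      simp only [F]
      rw [integral_add (hint (hc1 _)) (hint hcont), integral_mul_left_eq_self (c a) b]
    rw [hl, hr] at h1
    linarith
  -- ### the homomorphism `ψ = u + F ∘ p`
  have hadd : ∀ x y : UniversalCover G (1 : G),
      u (x * y) + F (projHom (x * y)) = (u x + F (projHom x)) + (u y + F (projHom y)) := by
    intro x y
    have h := hF (projHom x) (projHom y)
    rw [hcu, ← map_mul] at h
    linarith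
  refine ⟨fun y => u y + F (projHom y), hu.add (hF_cont.comp hpc), hadd, fun k => ?_⟩
  have h1 : u 1 + F (projHom 1) = 0 := by
    have h := hadd 1 1
    rw [mul_one] at h
    linarith
  have hk : projHom (k : UniversalCover G (1 : G)) = 1 := k.2
  have hu1 := hu_mul 1 k
  rw [one_mul] at hu1
  show u k + F (projHom (k : UniversalCover G (1 : G))) = φ (Additive.ofMul k)
  rw [hk, hu1]
  rw [map_one] at h1
  linarith

/-! ### Characters; homomorphisms `ker p → ℤ` -/

/-- **If every continuous character `χ : G →* Circle` of `G` is trivial, then every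
homomorphism `ker p → ℤ` vanishes** (`G` compact Hausdorff, path connected, strongly locally
contractible).  Extend `φ` to a continuous additive `ψ : G̃ → ℝ` (`exists_continuous_add_extend`);
`y ↦ e^{2πi ψ(y)}` is a character of `G̃` trivial on `ker p`, hence a continuous character of
`G = G̃ / ker p`; if that is trivial, `ψ` takes integer values on the path connected `G̃` and
vanishes at `1`, so `ψ = 0` and `φ = ψ|_{ker p} = 0`. [folklore] -/
theorem addMonoidHom_ker_eq_zero_of_forall_character [CompactSpace G] [T2Space G]
    [PathConnectedSpace G] [StronglyLocallyContractibleSpace G]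
    (hχ : ∀ χ : G →* Circle, Continuous χ → χ = 1)
    (φ : Additive (projHom (G := G)).ker →+ ℤ) : φ = 0 := by
  obtain ⟨ψ, hψc, hψadd, hψK⟩ := exists_continuous_add_extend ((Int.castAddHom ℝ).comp φ)
  have hsurj : Function.Surjective (projHom : UniversalCover G (1 : G) → G) := projHom_surjective
  have hψ1 : ψ 1 = 0 := by
    have h := hψadd 1 1
    rw [mul_one] at h
    linarith
  -- the character `e^{2πiψ}` of `G̃`
  let χt : UniversalCover G (1 : G) →* Circle :=
    { toFun := fun y => Circle.exp (2 * Real.pi * ψ y)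
      map_one' := by simp only [hψ1, mul_zero, Circle.exp_zero]
      map_mul' := fun x y => by simp only [hψadd, mul_add, Circle.exp_add] }
  have hχt_apply : ∀ y, χt y = Circle.exp (2 * Real.pi * ψ y) := fun _ => rfl
  have hχtK : ∀ k : UniversalCover G (1 : G), k ∈ (projHom (G := G)).ker → χt k = 1 := by
    intro k hk
    rw [hχt_apply, hψK ⟨k, hk⟩, AddMonoidHom.coe_comp, Function.comp_apply, Int.coe_castAddHom,
      Circle.exp_two_pi_mul_int]
  -- it is constant on the fibres of `p`, hence descends to a character of `G`
  let σ : G → UniversalCover G (1 : G) := Function.surjInv hsurj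
  have hσ : ∀ a, projHom (σ a) = a := Function.surjInv_eq hsurj
  have hdesc : ∀ y : UniversalCover G (1 : G), χt (σ (projHom y)) = χt y := by
    intro y
    have hk : y⁻¹ * σ (projHom y) ∈ (projHom (G := G)).ker := by
      rw [MonoidHom.mem_ker, map_mul, map_inv, hσ, inv_mul_cancel]
    calc χt (σ (projHom y)) = χt (y * (y⁻¹ * σ (projHom y))) := by rw [mul_inv_cancel_left]
      _ = χt y := by rw [map_mul, hχtK _ hk, mul_one]
  let χ : G →* Circle :=
    { toFun := fun a => χt (σ a)
      map_one' := by simpa using hdesc 1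
      map_mul' := fun a b => by
        obtain ⟨x, rfl⟩ := hsurj a
        obtain ⟨y, rfl⟩ := hsurj b
        rw [← map_mul, hdesc, hdesc, hdesc, map_mul] }
  have hχ_apply : ∀ y : UniversalCover G (1 : G), χ (projHom y) = χt y := fun y => hdesc y
  have hχc : Continuous χ := by
    have hq : IsQuotientMap (projHom : UniversalCover G (1 : G) → G) :=
      isCoveringMap_projHom.isQuotientMap hsurj
    rw [hq.continuous_iff]
    have : (χ : G → Circle) ∘ projHom = χt := funext fun y => hχ_apply y
    rw [this]
    exact Circle.exp.continuous.comp (continuous_const.mul hψc)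
  have h1 := hχ χ hχc
  -- hence `ψ` is integer valued, and being continuous on the path connected `G̃`, zero
  have hint : ∀ y, ∃ n : ℤ, ψ y = n := by
    intro y
    have hy : χt y = 1 := by rw [← hχ_apply, h1, MonoidHom.one_apply]
    rw [hχt_apply, Circle.exp_eq_one] at hy
    obtain ⟨n, hn⟩ := hy
    refine ⟨n, ?_⟩
    have h2π : (2 * Real.pi : ℝ) ≠ 0 := by positivity
    have : 2 * Real.pi * ψ y = 2 * Real.pi * n := by rw [hn]; ring
    exact mul_left_cancel₀ h2π this
  have hψ0 : ∀ y, ψ y = 0 := by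
    intro y
    obtain ⟨n, hn⟩ := hint y
    by_contra hne
    -- a value `± 1/2` between `ψ 1 = 0` and `ψ y = n ≠ 0` would be attained
    have hhalf : ∀ z, ψ z ≠ 1 / 2 ∧ ψ z ≠ -(1 / 2) := by
      intro z
      obtain ⟨m, hm⟩ := hint z
      rw [hm]
      constructor
      · intro h
        have : (2 * m : ℤ) = 1 := by exact_mod_cast (by linarith : (2 : ℝ) * m = 1)
        omega
      · intro h
        have : (2 * m : ℤ) = -1 := by exact_mod_cast (by linarith : (2 : ℝ) * m = -1)
        omega
    have hn0 : (n : ℝ) ≠ 0 := by rw [← hn]; exact hne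
    rcases lt_or_gt_of_ne hn0 with hneg | hpos
    · have hn1 : (n : ℝ) ≤ -1 := by
        have : n ≤ -1 := by
          have : n < 0 := by exact_mod_cast hneg
          omega
        exact_mod_cast this
      obtain ⟨z, hz⟩ := intermediate_value_univ y 1 hψc
        (show -(1 / 2 : ℝ) ∈ Icc (ψ y) (ψ 1) from ⟨by rw [hn]; linarith, by rw [hψ1]; linarith⟩)
      exact (hhalf z).2 hz
    · have hn1 : (1 : ℝ) ≤ n := by
        have : 1 ≤ n := by
          have : 0 < n := by exact_mod_cast hpos
          omega
        exact_mod_cast this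
      obtain ⟨z, hz⟩ := intermediate_value_univ 1 y hψc
        (show (1 / 2 : ℝ) ∈ Icc (ψ 1) (ψ y) from ⟨by rw [hψ1]; linarith, by rw [hn]; linarith⟩)
      exact (hhalf z).1 hz
  refine AddMonoidHom.ext fun k => ?_
  have h := hψK (Additive.toMul k)
  rw [hψ0, AddMonoidHom.coe_comp, Function.comp_apply, Int.coe_castAddHom, ofMul_toMul] at h
  rw [AddMonoidHom.zero_apply]
  have h' : ((φ k : ℤ) : ℝ) = 0 := h.symm
  exact_mod_cast h'

/-! ### `ker p ≅ π₁(G, 1)` as groups -/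

/-- **The deck transformation `α • ·` is left multiplication by `α • 1̃`** (both are lifts of
`p` through the covering `p` agreeing at `1̃`; Hatcher 2002, Prop. 1.34). [cite: HatcherAT2002, §1.3 Prop. 1.34] -/
theorem smul_eq_smul_one_mul [PathConnectedSpace G] [StronglyLocallyContractibleSpace G]
    (α : FundamentalGroup G (1 : G)) (y : UniversalCover G (1 : G)) :
    α • y = (α • (1 : UniversalCover G (1 : G))) * y := by
  have h := (isCoveringMap_projHom (G := G)).eq_of_comp_eq
    (g₁ := fun y : UniversalCover G (1 : G) => α • y)
    (g₂ := fun y : UniversalCover G (1 : G) => (α • (1 : UniversalCover G (1 : G))) * y)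
    (continuous_const_smul α) (continuous_const.mul continuous_id) ?_ 1 ?_
  · exact congrFun h y
  · funext y
    show projHom (α • y) = projHom ((α • (1 : UniversalCover G (1 : G))) * y)
    rw [map_mul, coe_projHom, proj_smul, proj_smul]
    show proj y = proj 1 * proj y
    rw [proj_one, one_mul]
  · show α • (1 : UniversalCover G (1 : G)) = (α • 1) * 1
    rw [mul_one]

/-- **`α ↦ α • 1̃` is multiplicative**: `(α β) • 1̃ = (α • 1̃) (β • 1̃)` in `G̃`.
[cite: Sepanski2007, Thm. 1.22] -/
theorem mul_smul_one [PathConnectedSpace G] [StronglyLocallyContractibleSpace G]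
    (α β : FundamentalGroup G (1 : G)) :
    (α * β) • (1 : UniversalCover G (1 : G)) = (α • (1 : UniversalCover G (1 : G))) * (β • 1) := by
  rw [mul_smul, smul_eq_smul_one_mul α (β • 1)]

/-- **`π₁(G, 1) ≅ ker p` as groups** (Sepanski 2007, Thm. 1.22 (4): "`π₁(G) ≅ ker π`"): the
bijection `α ↦ α • 1̃` (`bijective_smul_base`, `UniversalCoverGroupKernel.lean`) is a
homomorphism (`mul_smul_one`).  Stated as the existence of a `MulEquiv` whose underlying map is
`α ↦ α • 1̃`. [cite: Sepanski2007, Thm. 1.22] -/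
theorem exists_mulEquiv_ker_projHom [PathConnectedSpace G] [StronglyLocallyContractibleSpace G] :
    ∃ e : FundamentalGroup G (1 : G) ≃* (projHom (G := G)).ker,
      ∀ α, (e α : UniversalCover G (1 : G)) = α • base G 1 := by
  let f : FundamentalGroup G (1 : G) →* (projHom (G := G)).ker :=
    { toFun := fun α => ⟨α • base G 1, smul_base_mem_ker α⟩
      map_one' := Subtype.ext (one_smul _ _)
      map_mul' := fun α β => Subtype.ext (by
        show (α * β) • base G 1 = (α • base G 1) * (β • base G 1)
        rw [← one_eq_base, mul_smul_one]) }
  exact ⟨MulEquiv.ofBijective f bijective_smul_base, fun α => rfl⟩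

/-- `ker p` is finitely generated when `π₁(G, 1)` is. [folklore] -/
theorem fg_ker_projHom [PathConnectedSpace G] [StronglyLocallyContractibleSpace G]
    [Group.FG (FundamentalGroup G (1 : G))] : Group.FG (projHom (G := G)).ker := by
  obtain ⟨e, -⟩ := exists_mulEquiv_ker_projHom (G := G)
  exact Group.fg_of_surjective (f := e.toMonoidHom) e.surjective

/-! ### Finiteness of `π₁` -/

/-- **A finitely generated commutative group without non-zero homomorphisms to `ℤ` is finite**
(structure theorem: `A ≃ ℤⁿ × ⨁ ℤ/pᵉ`, and `n = 0` since a coordinate `A → ℤ` would be a non-zero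
homomorphism). [folklore] -/
theorem finite_of_fg_of_forall_addMonoidHom_int_eq_zero {A : Type*} [AddCommGroup A]
    [AddGroup.FG A] (h : ∀ φ : A →+ ℤ, φ = 0) : Finite A := by
  obtain ⟨n, ι, _, pr, hpr, e, ⟨f⟩⟩ := AddCommGroup.equiv_free_prod_directSum_zmod A
  have hn : n = 0 := by
    by_contra hn
    let i : Fin n := ⟨0, Nat.pos_of_ne_zero hn⟩
    let φ : A →+ ℤ :=
      ((Finsupp.applyAddHom i).comp (AddMonoidHom.fst _ _)).comp f.toAddMonoidHom
    have h1 : φ (f.symm (Finsupp.single i 1, 0)) = 1 := by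
      simp [φ]
    rw [h φ, AddMonoidHom.zero_apply] at h1
    exact zero_ne_one h1
  subst hn
  haveI : ∀ j, NeZero (pr j ^ e j) := fun j => ⟨pow_ne_zero _ (hpr j).ne_zero⟩
  haveI : Finite (DirectSum ι fun j => ZMod (pr j ^ e j)) :=
    Finite.of_injective (fun x j => x j) DFunLike.coe_injective
  haveI : Finite ((Fin 0 →₀ ℤ) × DirectSum ι fun j => ZMod (pr j ^ e j)) := inferInstance
  exact Finite.of_equiv _ f.toEquiv.symm

/-- **Finiteness of `π₁` from the absence of characters.**  For `G` compact Hausdorff, path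
connected, strongly locally contractible, with finitely generated `π₁(G, 1)` (e.g. a compact
connected topological manifold): if every continuous character `χ : G →* Circle` is trivial then
`π₁(G, 1)` is finite (`π₁(G, 1) ≅ ker p` is finitely generated, commutative — `ker p` is central —
and has no non-zero homomorphism to `ℤ`).  This is the covering-space half of Bröcker–tom Dieck
V (7.13) (i) ⇒ (iii) (there via the Stiefel diagram). [cite: BrockerTomDieck1985, V (7.13)] -/
theorem finite_fundamentalGroup_of_forall_character [CompactSpace G] [T2Space G]
    [PathConnectedSpace G] [StronglyLocallyContractibleSpace G]
    [Group.FG (FundamentalGroup G (1 : G))]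
    (hχ : ∀ χ : G →* Circle, Continuous χ → χ = 1) : Finite (FundamentalGroup G (1 : G)) := by
  letI : CommGroup (projHom (G := G)).ker :=
    { (inferInstance : Group (projHom (G := G)).ker) with
      mul_comm := fun a b => Subtype.ext (mul_comm_of_mem_ker a.2 b) }
  haveI : Group.FG (projHom (G := G)).ker := fg_ker_projHom
  have hfin : Finite (Additive (projHom (G := G)).ker) :=
    finite_of_fg_of_forall_addMonoidHom_int_eq_zero
      (addMonoidHom_ker_eq_zero_of_forall_character hχ)
  haveI : Finite (projHom (G := G)).ker := hfin
  exact Finite.of_equiv _ (Equiv.ofBijective _ (bijective_smul_base (G := G))).symm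

/-- **Compactness of the universal covering group from the absence of characters**: under the
hypotheses of `finite_fundamentalGroup_of_forall_character`, `G̃` is compact and `ker p` is
finite (Bröcker–tom Dieck V (7.13) (iii) ⇒ (iv), `UniversalCoverCompact.lean`).
[cite: BrockerTomDieck1985, V (7.13)] -/
theorem compactSpace_of_forall_character [CompactSpace G] [T2Space G]
    [PathConnectedSpace G] [StronglyLocallyContractibleSpace G]
    [Group.FG (FundamentalGroup G (1 : G))]
    (hχ : ∀ χ : G →* Circle, Continuous χ → χ = 1) :
    CompactSpace (UniversalCover G (1 : G)) ∧
      ((projHom (G := G)).ker : Set (UniversalCover G (1 : G))).Finite := by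
  haveI := finite_fundamentalGroup_of_forall_character hχ
  exact ⟨compactSpace_of_finite, finite_ker_projHom⟩

end UniversalCover

end Literature.Topology.CoveringSpaces
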